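import Literature.NumberTheory.Automorphic.PartialAsaiLHolomorphyRankOne
import Literature.NumberTheory.Automorphic.AsaiSignArchParityTwist
import Literature.NumberTheory.Automorphic.PairLFunctionMeromorphicContinuationRankNeTwistProofs
import Literature.NumberTheory.GaloisRepresentations.HeckeCharacterExtensionQuadraticGeneralProofs
import Literature.NumberTheory.Automorphic.AsaiAtOneOfFacts
import Literature.NumberTheory.Automorphic.AsaiAtOneConjSelfDualOfJS
import Literature.NumberTheory.Automorphic.AsaiSignContOfHumphriesJo
import HarnessLib

/-!
# Grbac–Shahidi 2015, Thm. 4.3 (1), (2)(a): the named fact `GrbacShahidi2015_partialAsaiL_holomorphy`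
# is implied by its own `As⁺` half in ranks `N ≥ 2` (sign reduction by the twist `σ ⊗ δ̂`, p. 206)

Topic `NumberTheory/Automorphic`; namespace `Literature.NumberTheory.Automorphic`.  Proof file
(theorems only: no definition, no named fact, no instance), sibling of `PartialAsaiLHolomorphy` (the
named fact: N. Grbac, F. Shahidi, *Endoscopic transfer for unitary groups and holomorphy of Asai
`L`-functions*, Pacific J. Math. 276 (2015), Thm. 4.3 (1), (2)(a), HOLOMORPHY clauses for the partial
Asai `L`-functions `L^S(s, Π₀, As^η)` of BOTH signs `η = ±1`, `L²` currency) and of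
`PartialAsaiLHolomorphyRankOne` (its `GL(1)` stratum, proved).

## What is proved

The fact's docstring records how the printed theorem covers both signs: "applied to `σ` and to
`σ ⊗ δ̂` (`L(s, σ ⊗ δ̂, r_A) = L(s, σ, As⁻)`)", `δ̂` being "any extension to `𝔸_E^×/E^×` of the quadratic
character of `𝔸_F^×/F^×` attached to `E/F`" (Grbac–Shahidi p. 186 and proof of Thm. 4.3, p. 206; Mok,
§2.5, arXiv p. 20: `L(s, φ^N, As⁻) = L(s, φ^N ⊗ χ_-, As⁺)` for `χ_- ∈ 𝒵_E^-`).  This file performs that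
step INSIDE the tree, so that the named fact shrinks to its `As⁺` half:

* `partialAsaiL_neg_eq_partialAsaiL_heckeTwist` — currency-free, factor by factor:
  `L^S(s, A, As^{-η}) = L^S(s, δ̂(ϖ) • A, As^η)` for a Hecke character `δ̂` of `E` over the class-field
  character `ω_{E/F}` unramified at the places unramified over `F`, off any `S` beyond which the
  `c`-fixed places are inert (`partialAsaiL_twist_eq_partialAsaiLTwist`, `partialAsaiLTwist_quadraticSign`
  of `TwistedAsaiPole`; the values `δ̂(ϖ_w) = -1` (inert), `δ̂(ϖ_w) δ̂(ϖ_{c w}) = 1` (split) from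
  `AsaiSignArchParityTwist`).
* `isConjSelfDualAE_of_heckeTwist` — `A` is conjugate self-dual a.e. (`A_{c w} = A_w⁻¹`) as soon as
  `δ̂(ϖ) • A` is, for any conjugate self-dual `δ̂` (`δ̂(c • y) δ̂(y) = 1`).
* `asaiHolomorphyL2_of_pos` (**the reduction**, one quadratic extension, one rank, one automorphic
  measure at a time) — if the conclusion of the fact holds at `η = +1` for every cuspidal
  `P ≤ L²_cusp(GL_N(E) A_G \ GL_N(𝔸_E), μ)` and every admissible `(S, A)`, it holds at both signs: for
  `η = -1` apply the hypothesis to the twist `P ⊗ δ̂ = P.twistByChar δ̂` (`AutomorphicTwist`; Arthur–Clozel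
  Ch. 3 Thm. 4.2 (b)) and its `L²` Satake family `δ̂(ϖ) • A` (`IsSatakeFamilyOf.twistByChar_of_isUnramifiedAt`),
  where `δ̂` — unitary, over `ω_{E/F}`, unramified at the places unramified over `F`, trivial on `A_G` — is
  supplied by `exists_heckeCharacter_restrict_eq_classFieldCharacter` fed with the tree's PROVED extension
  theorem `HewittRoss_heckeCharacter_extension_quadratic_holds` (Weil's extension principle + Dirichlet).
* `GrbacShahidi2015_partialAsaiL_holomorphy_of_pos` — the named fact from its `As⁺` half;
  `…_of_pos_of_two_le` — from its `As⁺` half in ranks `N ≥ 2` (with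
  `GrbacShahidi2015_partialAsaiL_holomorphy_rank_one`); `…_iff_pos_of_two_le` — the equivalence.
* Consequences for the two named Asai facts at `s = 1`, both closed modulo the fact by accepted glue:
  `GrbacShahidi2015_partialAsaiL_at_one_of_pos_of_MW` (`As⁺` half, `N ≥ 2`, + Mœglin–Waldspurger's
  Corollaire (ii)), `Mok2014_partialAsaiL_continuation_pole_dichotomy_of_pos_of_JS` (`As⁺` half, `N ≥ 2`,
  + Arthur–Clozel's (2.3)), `GrbacShahidi2015_partialAsaiL_at_one_of_pos_of_JS_of_isConjSelfDualAE` (the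
  conjugate-self-dual stratum of the former from the same two inputs).
* §5, clause (2)(a) alone: `asaiEntireL2_of_pos` (pointwise sign reduction for the entire continuation of
  `s (s - 1) L^S(s, A, As^η)` only — the hypothesis shape `hGSa` of the sibling files),
  `asaiEntireL2_of_pos_of_two_le` (`hGSa` for both signs and all ranks from its `As⁺`, `N ≥ 2` part), and,
  with the archimedean Rankin–Selberg named fact `HumphriesJo2024_archRankinSelberg_testVector` (which the
  tree has shown to imply Arthur–Clozel's (2.3) in ranks `≥ 3`, `AsaiSignContOfHumphriesJo`):
  `Mok2014_partialAsaiL_continuation_pole_dichotomy_of_posEntire_of_humphriesJo`,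
  `GrbacShahidi2015_partialAsaiL_at_one_of_posEntire_of_humphriesJo_of_isConjSelfDualAE` and the pointwise
  `CuspidalAutomorphicRepData.GrbacShahidi2015_partialAsaiL_at_one_of_asaiEntirePos_of_humphriesJo` — so
  the leaf set of Mok's dichotomy and of the conjugate-self-dual stratum of the fact at `s = 1` is
  {entire continuation of `s (s - 1) L^S(s, Π, As⁺)`, `N ≥ 2`; Humphries–Jo, `N ≥ 3`}.

What remains of `GrbacShahidi2015_partialAsaiL_holomorphy` after this file and
`PartialAsaiLHolomorphyRankOne`: Grbac–Shahidi's Thm. 4.3 (1), (2)(a) for the Asai representation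
`r_A = As⁺` proper and `N ≥ 2` — on Flicker's road (Bull. SMF 116 (1988), Theorem p. 297), the entire
continuation of `s (s - 1) L(s, r(π), V)` from the Rankin–Selberg integral of `φ|_{GL_N(𝔸_F)}` against the
mirabolic Eisenstein series of `GL_N(𝔸_F)` (bricks in the tree: `RankinSelbergIntegralEntireBounded`,
`AsaiUnramifiedTorus`, `LittlewoodIdentity*`) and "pole at `s = 1` ⇒ distinguished ⇒ Galois self-dual".
No archimedean or trace-formula input is used here; axioms `propext`, `Classical.choice`, `Quot.sound`.

## References

* N. Grbac, F. Shahidi, *Endoscopic transfer for unitary groups and holomorphy of Asai `L`-functions*,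
  Pacific J. Math. 276 (2015), 185–211: Thm. 4.3 (1), (2)(a) (pp. 186, 204) and its proof, p. 206
  (`L(s, σ ⊗ δ̂, r_A)`). [GrbacShahidi2015]
* C. P. Mok, *Endoscopic classification of representations of quasi-split unitary groups*, Mem. AMS 235
  (2015) no. 1108 = arXiv:1206.0882, §2.1 (p. 7: `𝒵_E^-`), §2.5 (p. 20). [Mok2014]
* W. T. Gan, B. Gross, D. Prasad, Astérisque 346 (2012), §7 (`As⁻ = As⁺ ⊗ ω_{k/k₀}`). [GanGrossPrasad2012]
* J. Arthur, L. Clozel, Ann. of Math. Stud. 120 (1989), Ch. 3, Thm. 4.2 (b) and proof of Thm. 3.1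
  (p. 172: `t_{π ⊗ η, v} = η(ϖ_v) t_{π, v}`). [ArthurClozelAMS120]
* Y. Z. Flicker, *Twisted tensors and Euler products*, Bull. SMF 116 (1988), p. 296 ("replace `π` by its
  product with a character") and Theorem p. 297. [Flicker1988]
* P. Humphries, Y. Jo, *Test vectors for archimedean period integrals*, Publ. Mat. 68 (2024), Thm. 1.1,
  Thm. 5.6. [HumphriesJo2024]
-/

noncomputable section

open scoped Topology NNReal Classical MatrixGroups
open NumberField IsDedekindDomain MeasureTheory Filter

namespace Literature.NumberTheory.Automorphic

open Literature.NumberTheory.GaloisRepresentations AdelicGroupData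

variable {F E : Type} [Field F] [NumberField F] [Field E] [NumberField E] [Algebra F E]

/-! ### §1. Currency-free: `L^S(s, A, As⁻) = L^S(s, δ̂(ϖ) • A, As⁺)` and conjugate self-duality -/

section SatakeAlgebra

/-- Scaling a multiset by `u` and then by `u⁻¹` is the identity (`u ≠ 0`). [folklore] -/
theorem multiset_map_inv_mul_map_mul {u : ℂ} (hu : u ≠ 0) (α : Multiset ℂ) :
    (α.map (u * ·)).map (u⁻¹ * ·) = α := by
  rw [Multiset.map_map]
  conv_rhs => rw [← Multiset.map_id' α]
  refine Multiset.map_congr rfl fun a _ => ?_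
  simp only [Function.comp_apply, ← mul_assoc, inv_mul_cancel₀ hu, one_mul]

/-- **`L^S(s, A, As^{-η}) = L^S(s, δ̂(ϖ) • A, As^η)` factor by factor** (Grbac–Shahidi p. 206:
`L(s, σ ⊗ δ̂, r_A) = L(s, σ, As⁻)`; Mok §2.5, arXiv p. 20; Gan–Gross–Prasad §7: `As⁻ = As⁺ ⊗ ω_{E/F}`).
Here `E/F` is quadratic with non-trivial automorphism `c`, `μ` is a Hecke character of `E` over the
class-field character `η₀ = ω_{E/F}` of `F` (`μ ∘ BC = η₀`), unramified at the places of `E` unramified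
over `F`, and the `c`-fixed places of `E` off `S` are inert: then twisting the Satake family by the
values `μ(ϖ_w)` turns the partial `As^{-η}`-product into the partial `As^η`-product, because
`μ(ϖ_w) = η₀(ϖ_v) = -1` at an inert and `μ(ϖ_w) μ(ϖ_{c w}) = η₀(ϖ_v) = 1` at a split unramified `v ∉ S`
(`partialAsaiL_twist_eq_partialAsaiLTwist`, `partialAsaiLTwist_quadraticSign`).
[cite: GrbacShahidi2015, proof of Thm. 4.3, p. 206] [cite: Mok2014, §2.5 (arXiv p. 20)] -/
theorem partialAsaiL_neg_eq_partialAsaiL_heckeTwist (h2 : Module.finrank F E = 2) {c : E ≃ₐ[F] E}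
    (hc : c ≠ 1) {μ : HeckeCharacter E} {η₀ : HeckeCharacter F} (hη₀ : η₀.IsClassFieldCharacter E)
    (hres : ∀ x, μ (AdeleRing.ideleBaseChange F E x) = η₀ x)
    (hunr : ∀ w : HeightOneSpectrum (𝓞 E), w.asIdeal.ramificationIdx (𝓞 F) = 1 → μ.IsUnramifiedAt w)
    {S : Set (HeightOneSpectrum (𝓞 F))}
    (hin : ∀ w : HeightOneSpectrum (𝓞 E), w.under (𝓞 F) ∉ S → c • w = w →
      w.asIdeal.inertiaDeg (𝓞 F) = 2)
    (A : SatakeFamily E) (η : ℤˣ) (s : ℂ) :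
    partialAsaiL S c A (-η) s =
      partialAsaiL S c (fun w => (A w).map (μ.valueAtUniformizer w * ·)) η s := by
  -- above the complement of `S` every place is unramified over `F`, so `μ` is unramified there
  have he : ∀ w : HeightOneSpectrum (𝓞 E), w.under (𝓞 F) ∉ S → w.asIdeal.ramificationIdx (𝓞 F) = 1 :=
    fun w hw => HeightOneSpectrum.ramificationIdx_eq_one_of_asai h2 (hin w hw)
  have hμ : ∀ w : HeightOneSpectrum (𝓞 E), w.under (𝓞 F) ∉ S → μ.IsUnramifiedAt w :=
    fun w hw => hunr w (he w hw)
  have hμc : ∀ w : HeightOneSpectrum (𝓞 E), w.under (𝓞 F) ∉ S → μ.IsUnramifiedAt (c • w) :=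
    fun w hw => hμ (c • w) (by rwa [HeightOneSpectrum.under_algEquiv_smul F E c w])
  set A' : SatakeFamily E := fun w => (A w).map (μ.valueAtUniformizer w * ·) with hA'
  set t : HeightOneSpectrum (𝓞 E) → ℂ := fun w => (μ.valueAtUniformizer w)⁻¹ with ht
  -- untwisting `A'` by `t = μ(ϖ)⁻¹` gives back `A`
  have hAA : (fun w => (A' w).map (t w * ·)) = A := by
    funext w
    exact multiset_map_inv_mul_map_mul (μ.valueAtUniformizer_ne_zero' w) (A w)
  have key := partialAsaiL_twist_eq_partialAsaiLTwist S c A' t (m := fun v => (η₀.valueAtUniformizer v)⁻¹)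
    (fun w hw hcw => by
      rw [ht, HeckeCharacter.valueAtUniformizer_restrict_of_smul_eq h2 hc hres hcw (he w hw) (hμ w hw)])
    (fun w hw hcw => by
      rw [ht, HeckeCharacter.valueAtUniformizer_restrict_of_smul_ne h2 hc hres hcw (he w hw) (hμ w hw)
        (hμc w hw), mul_inv])
    (-η) s
  rw [hAA] at key
  rw [key, partialAsaiLTwist_quadraticSign S c A'
      (fun w hw hcw => by
        rw [hη₀.valueAtUniformizer_under_eq_neg_one h2 (hin w hw hcw)]
        norm_num)
      (fun w _ hcw => by
        rw [hη₀.isTrivialOnNormGroup.valueAtUniformizer_under_eq_one_of_smul_ne h2 hcw, inv_one])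
      (-η) s, neg_neg]

omit [NumberField F] in
/-- **Conjugate self-duality is invariant under the twist by a conjugate self-dual character** (almost
everywhere on Satake families): if `μ(c • y) μ(y) = 1` on `𝕀_E` (e.g. `μ` over `ω_{E/F}` or over `1`,
`HeckeCharacter.apply_smul_mul_eq_one_of_restrict`) and the twisted family `w ↦ μ(ϖ_w) A_w` satisfies
`A'_{c w} = A'_w⁻¹` for almost all `w`, then so does `A` — Mok's signature calculus (§2.1, arXiv pp. 7–8)
read on Satake parameters: `μ(ϖ_{c w}) = μ(ϖ_w)⁻¹` at the unramified places. [cite: Mok2014, §2.1 (last diagram), arXiv pp. 7–8] -/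
theorem isConjSelfDualAE_of_heckeTwist {c : E ≃ₐ[F] E} {μ : HeckeCharacter E}
    (hdual : ∀ y : ideleGroup E, μ (c • y) * μ y = 1) {A : SatakeFamily E}
    (h : ∀ᶠ w : HeightOneSpectrum (𝓞 E) in cofinite,
      (fun w => (A w).map (μ.valueAtUniformizer w * ·)) (c • w) =
        ((fun w => (A w).map (μ.valueAtUniformizer w * ·)) w).map (·⁻¹)) :
    ∀ᶠ w : HeightOneSpectrum (𝓞 E) in cofinite, A (c • w) = (A w).map (·⁻¹) := by
  have hur : ∀ᶠ w : HeightOneSpectrum (𝓞 E) in cofinite, μ.IsUnramifiedAt w :=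
    μ.finite_ramifiedPlaces_iff.1 (HeckeCharacter.finite_ramifiedPlaces_holds _)
  have hinj : Function.Injective fun w : HeightOneSpectrum (𝓞 E) => c • w := MulAction.injective c
  have hur' := hinj.tendsto_cofinite.eventually hur
  filter_upwards [h, hur'] with w hw hu'
  have huu := HeckeCharacter.valueAtUniformizer_smul_mul_eq_one hdual hu'
  set u := μ.valueAtUniformizer w with hu_def
  set u' := μ.valueAtUniformizer (c • w) with hu'_def
  have hu0 : u ≠ 0 := μ.valueAtUniformizer_ne_zero' w
  have hu'0 : u' ≠ 0 := μ.valueAtUniformizer_ne_zero' (c • w)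
  have hu'u : u' = u⁻¹ := eq_inv_of_mul_eq_one_left huu
  -- `hw : (A (c • w)).map (u' * ·) = ((A w).map (u * ·)).map (·⁻¹)`
  have hw' : (A (c • w)).map (u' * ·) = (A w).map (fun a => u' * a⁻¹) := by
    rw [hw, Multiset.map_map]
    refine Multiset.map_congr rfl fun a _ => ?_
    simp only [Function.comp_apply, mul_inv, hu'u]
  calc A (c • w) = ((A (c • w)).map (u' * ·)).map (u'⁻¹ * ·) :=
        (multiset_map_inv_mul_map_mul hu'0 _).symm
    _ = ((A w).map (fun a => u' * a⁻¹)).map (u'⁻¹ * ·) := by rw [hw']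
    _ = (A w).map (·⁻¹) := by
        rw [Multiset.map_map]
        refine Multiset.map_congr rfl fun a _ => ?_
        simp only [Function.comp_apply, ← mul_assoc, inv_mul_cancel₀ hu'0, one_mul]

end SatakeAlgebra

/-! ### §2. The sign reduction in `L²` currency, one rank and one measure at a time -/

section LTwo

/-- **Sign reduction, pointwise** (Grbac–Shahidi, proof of Thm. 4.3, p. 206: "the twisted Asai
`L`-function `L(s, σ ⊗ δ̂, r_A)`, where `δ̂` is any extension to `𝔸_E^×/E^×` of the quadratic character
… attached to `E/F`"; Mok §2.5, arXiv p. 20: `L(s, φ^N, As⁻) = L(s, φ^N ⊗ χ_-, As⁺)`).  Fix the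
quadratic `E/F` (`c ≠ 1`), the rank `N` and the automorphic measure `μ`.  If for EVERY cuspidal
`P ≤ L²_cusp(GL_N(E) A_G \ GL_N(𝔸_E), μ)`, every finite `S` off which the `c`-fixed places are inert and
every `L²` Satake family `A` of `P` off `S_E` the conclusion of `GrbacShahidi2015_partialAsaiL_holomorphy`
holds for the sign `η = +1`, then it holds for both signs.  Proof: for `η = -1` take a unitary Hecke
character `δ̂` of `E` over the class-field character `ω_{E/F}`, unramified at the places unramified over
`F` (`exists_heckeCharacter_restrict_eq_classFieldCharacter`, fed with the tree's PROVED extension theorem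
`HewittRoss_heckeCharacter_extension_quadratic_holds`); it is trivial on `A_G` (`ω_{E/F}` has finite
order, `ideleBaseChange_posRealIdele`), so `P ⊗ δ̂ = P.twistByChar δ̂` is a cuspidal constituent of the
same `L²_cusp` (Arthur–Clozel Ch. 3 Thm. 4.2 (b)) with `L²` Satake family `w ↦ δ̂(ϖ_w) A_w` off `S_E`
(`IsSatakeFamilyOf.twistByChar_of_isUnramifiedAt`; above `v ∉ S` every place is unramified over `F`);
by §1 `L^S(s, A, As⁻) = L^S(s, δ̂(ϖ) A, As⁺)` and `A` is conjugate self-dual a.e. iff `δ̂(ϖ) A` is, so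
the `η = +1` conclusion for `(P ⊗ δ̂, S, δ̂(ϖ) A)` is the `η = -1` conclusion for `(P, S, A)`.
[cite: GrbacShahidi2015, proof of Thm. 4.3, p. 206] [cite: Mok2014, §2.5 (arXiv p. 20)]
[cite: ArthurClozelAMS120, Ch. 3, Thm. 4.2 (b) and proof of Thm. 3.1 (p. 172)] -/
theorem asaiHolomorphyL2_of_pos (h2 : Module.finrank F E = 2) {c : E ≃ₐ[F] E} (hc : c ≠ 1) {N : ℕ}
    {μ : Measure (gl N E).automorphicQuotient} [(gl N E).IsAutomorphicMeasure μ]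
    (hpos : ∀ (P : CuspidalAutomorphicRepGL N E μ) (S : Set (HeightOneSpectrum (𝓞 F)))
      (A : SatakeFamily E), S.Finite →
      IsSatakeFamilyOf P {w : HeightOneSpectrum (𝓞 E) | w.under (𝓞 F) ∈ S} A →
      (∀ w : HeightOneSpectrum (𝓞 E), w.under (𝓞 F) ∉ S → c • w = w →
        w.asIdeal.inertiaDeg (𝓞 F) = 2) →
      ∃ σ₀ : ℝ, 1 ≤ σ₀ ∧
        (∃ G : ℂ → ℂ, Differentiable ℂ G ∧
          ∀ s : ℂ, σ₀ < s.re → G s = s * (s - 1) * partialAsaiL S c A 1 s) ∧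
        ((¬ ∀ᶠ w : HeightOneSpectrum (𝓞 E) in cofinite, A (c • w) = (A w).map (·⁻¹)) →
          ∃ H : ℂ → ℂ, Differentiable ℂ H ∧
            ∀ s : ℂ, σ₀ < s.re → H s = partialAsaiL S c A 1 s))
    (P : CuspidalAutomorphicRepGL N E μ) (S : Set (HeightOneSpectrum (𝓞 F))) (A : SatakeFamily E)
    (η : ℤˣ) (hS : S.Finite)
    (hA : IsSatakeFamilyOf P {w : HeightOneSpectrum (𝓞 E) | w.under (𝓞 F) ∈ S} A)
    (hin : ∀ w : HeightOneSpectrum (𝓞 E), w.under (𝓞 F) ∉ S → c • w = w →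
      w.asIdeal.inertiaDeg (𝓞 F) = 2) :
    ∃ σ₀ : ℝ, 1 ≤ σ₀ ∧
      (∃ G : ℂ → ℂ, Differentiable ℂ G ∧
        ∀ s : ℂ, σ₀ < s.re → G s = s * (s - 1) * partialAsaiL S c A η s) ∧
      ((¬ ∀ᶠ w : HeightOneSpectrum (𝓞 E) in cofinite, A (c • w) = (A w).map (·⁻¹)) →
        ∃ H : ℂ → ℂ, Differentiable ℂ H ∧
          ∀ s : ℂ, σ₀ < s.re → H s = partialAsaiL S c A η s) := by
  rcases Int.units_eq_one_or η with rfl | rfl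
  · exact hpos P S A hS hA hin
  · -- `η = -1`: twist by a character `δ̂` over `ω_{E/F}` (Mok's `𝒵_E^-`)
    obtain ⟨η₀, χ, hη₀, hχu, hres, hunr⟩ :=
      exists_heckeCharacter_restrict_eq_classFieldCharacter
        HewittRoss_heckeCharacter_extension_quadratic_holds F E c h2 hc
    -- `δ̂` is trivial on `A_G = ℝ_{>0}`: `δ̂(z_E(t)) = ω_{E/F}(z_F(t)) = 1`
    have hχ₀ : ∀ t, χ (posRealIdele E t) = 1 := fun t => by
      have h := hres (posRealIdele F t)
      rw [AdeleRing.ideleBaseChange_posRealIdele] at h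
      rw [h]
      exact HeckeCharacter.map_posRealIdele_of_isFiniteOrder hη₀.isFiniteOrder t
    have he : ∀ w : HeightOneSpectrum (𝓞 E), w.under (𝓞 F) ∉ S →
        w.asIdeal.ramificationIdx (𝓞 F) = 1 :=
      fun w hw => HeightOneSpectrum.ramificationIdx_eq_one_of_asai h2 (hin w hw)
    -- the twist `P ⊗ δ̂` and its `L²` Satake family `δ̂(ϖ) A` off `S_E`
    have hA' : IsSatakeFamilyOf (P.twistByChar χ hχu hχ₀)
        {w : HeightOneSpectrum (𝓞 E) | w.under (𝓞 F) ∈ S}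
        (fun w => (A w).map (χ.valueAtUniformizer w * ·)) :=
      hA.twistByChar_of_isUnramifiedAt χ hχu hχ₀ fun w hw => hunr w (he w hw)
    obtain ⟨σ₀, hσ₀, ⟨G, hG, hGeq⟩, hH⟩ := hpos _ S _ hS hA' hin
    have heq : ∀ s : ℂ, partialAsaiL S c A (-1) s =
        partialAsaiL S c (fun w => (A w).map (χ.valueAtUniformizer w * ·)) 1 s :=
      fun s => partialAsaiL_neg_eq_partialAsaiL_heckeTwist h2 hc hη₀ hres hunr hin A 1 s
    refine ⟨σ₀, hσ₀, ⟨G, hG, fun s hs => by rw [hGeq s hs, heq s]⟩, fun hncsd => ?_⟩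
    have hdual : ∀ y : ideleGroup E, χ (c • y) * χ y = 1 :=
      HeckeCharacter.apply_smul_mul_eq_one_of_restrict h2 hc hres hη₀.isTrivialOnNormGroup
    obtain ⟨H, hH', hHeq⟩ := hH fun h' => hncsd (isConjSelfDualAE_of_heckeTwist hdual h')
    exact ⟨H, hH', fun s hs => by rw [hHeq s hs, heq s]⟩

end LTwo

/-! ### §3. The named fact from its `As⁺` half -/

section NamedFact

/-- **`GrbacShahidi2015_partialAsaiL_holomorphy` is implied by its own `As⁺` half** (the statement of
the named fact with the sign binder `η` specialised to `+1`, i.e. Grbac–Shahidi's Thm. 4.3 (1), (2)(a)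
for the Asai `L`-function `L(s, σ, r_A)` proper — equivalently Flicker's twisted tensor `L`-function
`L(s, r(π), V)` —, in the tree's `L²` currency): the `As⁻` half is the `As⁺` half at `σ ⊗ δ̂`
(`asaiHolomorphyL2_of_pos`). [cite: GrbacShahidi2015, Thm. 4.3 (1), (2)(a) and proof p. 206]
[cite: Mok2014, §2.5 (arXiv p. 20)] -/
theorem GrbacShahidi2015_partialAsaiL_holomorphy_of_pos
    (h : ∀ (F E : Type) [Field F] [NumberField F] [Field E] [NumberField E] [Algebra F E]
      (c : E ≃ₐ[F] E), Module.finrank F E = 2 → c ≠ 1 →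
      ∀ (N : ℕ) (μ : Measure (gl N E).automorphicQuotient) [(gl N E).IsAutomorphicMeasure μ]
        (P : CuspidalAutomorphicRepGL N E μ), 0 < N →
        ∀ (S : Set (HeightOneSpectrum (𝓞 F))) (A : SatakeFamily E), S.Finite →
          IsSatakeFamilyOf P {w : HeightOneSpectrum (𝓞 E) | w.under (𝓞 F) ∈ S} A →
          (∀ w : HeightOneSpectrum (𝓞 E), w.under (𝓞 F) ∉ S → c • w = w →
            w.asIdeal.inertiaDeg (𝓞 F) = 2) →
          ∃ σ₀ : ℝ, 1 ≤ σ₀ ∧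
            (∃ G : ℂ → ℂ, Differentiable ℂ G ∧
              ∀ s : ℂ, σ₀ < s.re → G s = s * (s - 1) * partialAsaiL S c A 1 s) ∧
            ((¬ ∀ᶠ w : HeightOneSpectrum (𝓞 E) in cofinite, A (c • w) = (A w).map (·⁻¹)) →
              ∃ H : ℂ → ℂ, Differentiable ℂ H ∧
                ∀ s : ℂ, σ₀ < s.re → H s = partialAsaiL S c A 1 s)) :
    GrbacShahidi2015_partialAsaiL_holomorphy := by
  intro F E _ _ _ _ _ c h2 hc N μ _ P hN S A η hS hA hin
  exact asaiHolomorphyL2_of_pos h2 hc (fun P S A hS hA hin => h F E c h2 hc N μ P hN S A hS hA hin)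
    P S A η hS hA hin

/-- **… and already by its `As⁺` half in ranks `N ≥ 2`**: the `GL(1)` stratum of the fact is the
tree's theorem `GrbacShahidi2015_partialAsaiL_holomorphy_rank_one` (Hecke–Tate), so what remains of
`GrbacShahidi2015_partialAsaiL_holomorphy` is Grbac–Shahidi's Thm. 4.3 (1), (2)(a) for `r_A = As⁺` and
`N ≥ 2` — on Flicker's road, the entire continuation of `s (s - 1) L(s, r(π), V)` from the
Rankin–Selberg integral against the mirabolic Eisenstein series of `GL_N(𝔸_F)` (Flicker 1988, Theorem
p. 297) together with "pole at `s = 1` ⇒ `π` distinguished ⇒ `π` Galois self-dual".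
[cite: GrbacShahidi2015, Thm. 4.3 (1), (2)(a) and proof p. 206] [cite: Flicker1988, Theorem p. 297] -/
theorem GrbacShahidi2015_partialAsaiL_holomorphy_of_pos_of_two_le
    (h : ∀ (F E : Type) [Field F] [NumberField F] [Field E] [NumberField E] [Algebra F E]
      (c : E ≃ₐ[F] E), Module.finrank F E = 2 → c ≠ 1 →
      ∀ (N : ℕ) (μ : Measure (gl N E).automorphicQuotient) [(gl N E).IsAutomorphicMeasure μ]
        (P : CuspidalAutomorphicRepGL N E μ), 2 ≤ N →
        ∀ (S : Set (HeightOneSpectrum (𝓞 F))) (A : SatakeFamily E), S.Finite →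
          IsSatakeFamilyOf P {w : HeightOneSpectrum (𝓞 E) | w.under (𝓞 F) ∈ S} A →
          (∀ w : HeightOneSpectrum (𝓞 E), w.under (𝓞 F) ∉ S → c • w = w →
            w.asIdeal.inertiaDeg (𝓞 F) = 2) →
          ∃ σ₀ : ℝ, 1 ≤ σ₀ ∧
            (∃ G : ℂ → ℂ, Differentiable ℂ G ∧
              ∀ s : ℂ, σ₀ < s.re → G s = s * (s - 1) * partialAsaiL S c A 1 s) ∧
            ((¬ ∀ᶠ w : HeightOneSpectrum (𝓞 E) in cofinite, A (c • w) = (A w).map (·⁻¹)) →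
              ∃ H : ℂ → ℂ, Differentiable ℂ H ∧
                ∀ s : ℂ, σ₀ < s.re → H s = partialAsaiL S c A 1 s)) :
    GrbacShahidi2015_partialAsaiL_holomorphy := by
  refine GrbacShahidi2015_partialAsaiL_holomorphy_of_two_le ?_
  intro F E _ _ _ _ _ c h2 hc N μ _ P hN2 S A η hS hA hin
  exact asaiHolomorphyL2_of_pos h2 hc (fun P S A hS hA hin => h F E c h2 hc N μ P hN2 S A hS hA hin)
    P S A η hS hA hin

/-- **Equivalence**: the named fact `GrbacShahidi2015_partialAsaiL_holomorphy` (both signs, all ranks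
`N ≥ 1`) is EQUIVALENT to its `As⁺` half in ranks `N ≥ 2` (the forward direction is specialisation).
[cite: GrbacShahidi2015, Thm. 4.3 (1), (2)(a) and proof p. 206] -/
theorem GrbacShahidi2015_partialAsaiL_holomorphy_iff_pos_of_two_le :
    GrbacShahidi2015_partialAsaiL_holomorphy ↔
      ∀ (F E : Type) [Field F] [NumberField F] [Field E] [NumberField E] [Algebra F E]
        (c : E ≃ₐ[F] E), Module.finrank F E = 2 → c ≠ 1 →
        ∀ (N : ℕ) (μ : Measure (gl N E).automorphicQuotient) [(gl N E).IsAutomorphicMeasure μ]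
          (P : CuspidalAutomorphicRepGL N E μ), 2 ≤ N →
          ∀ (S : Set (HeightOneSpectrum (𝓞 F))) (A : SatakeFamily E), S.Finite →
            IsSatakeFamilyOf P {w : HeightOneSpectrum (𝓞 E) | w.under (𝓞 F) ∈ S} A →
            (∀ w : HeightOneSpectrum (𝓞 E), w.under (𝓞 F) ∉ S → c • w = w →
              w.asIdeal.inertiaDeg (𝓞 F) = 2) →
            ∃ σ₀ : ℝ, 1 ≤ σ₀ ∧
              (∃ G : ℂ → ℂ, Differentiable ℂ G ∧
                ∀ s : ℂ, σ₀ < s.re → G s = s * (s - 1) * partialAsaiL S c A 1 s) ∧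
              ((¬ ∀ᶠ w : HeightOneSpectrum (𝓞 E) in cofinite, A (c • w) = (A w).map (·⁻¹)) →
                ∃ H : ℂ → ℂ, Differentiable ℂ H ∧
                  ∀ s : ℂ, σ₀ < s.re → H s = partialAsaiL S c A 1 s) :=
  ⟨fun h F E _ _ _ _ _ c h2 hc N μ _ P hN2 S A hS hA hin =>
      h F E c h2 hc N μ P (by omega) S A 1 hS hA hin,
    GrbacShahidi2015_partialAsaiL_holomorphy_of_pos_of_two_le⟩

end NamedFact

/-! ### §4. Consequences for the two named Asai facts at `s = 1` -/

section Consequences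

/-- **`GrbacShahidi2015_partialAsaiL_at_one` from the `As⁺` half of Grbac–Shahidi's holomorphy in ranks
`N ≥ 2` and Mœglin–Waldspurger's Corollaire (ii)** — the accepted glue
`GrbacShahidi2015_partialAsaiL_at_one_of_facts` (`AsaiAtOneOfFacts`) composed with
`GrbacShahidi2015_partialAsaiL_holomorphy_of_pos_of_two_le`.
[cite: GrbacShahidi2015, Thm. 4.3 and its proof, pp. 204–206] [cite: MoeglinWaldspurger1989, Appendice, Corollaire (ii)] -/
theorem GrbacShahidi2015_partialAsaiL_at_one_of_pos_of_MW
    (h : ∀ (F E : Type) [Field F] [NumberField F] [Field E] [NumberField E] [Algebra F E]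
      (c : E ≃ₐ[F] E), Module.finrank F E = 2 → c ≠ 1 →
      ∀ (N : ℕ) (μ : Measure (gl N E).automorphicQuotient) [(gl N E).IsAutomorphicMeasure μ]
        (P : CuspidalAutomorphicRepGL N E μ), 2 ≤ N →
        ∀ (S : Set (HeightOneSpectrum (𝓞 F))) (A : SatakeFamily E), S.Finite →
          IsSatakeFamilyOf P {w : HeightOneSpectrum (𝓞 E) | w.under (𝓞 F) ∈ S} A →
          (∀ w : HeightOneSpectrum (𝓞 E), w.under (𝓞 F) ∉ S → c • w = w →
            w.asIdeal.inertiaDeg (𝓞 F) = 2) →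
          ∃ σ₀ : ℝ, 1 ≤ σ₀ ∧
            (∃ G : ℂ → ℂ, Differentiable ℂ G ∧
              ∀ s : ℂ, σ₀ < s.re → G s = s * (s - 1) * partialAsaiL S c A 1 s) ∧
            ((¬ ∀ᶠ w : HeightOneSpectrum (𝓞 E) in cofinite, A (c • w) = (A w).map (·⁻¹)) →
              ∃ H : ℂ → ℂ, Differentiable ℂ H ∧
                ∀ s : ℂ, σ₀ < s.re → H s = partialAsaiL S c A 1 s))
    (hMW : ∀ (E : Type) [Field E] [NumberField E] (N : ℕ)
      (μ : Measure (gl N E).automorphicQuotient) [(gl N E).IsAutomorphicMeasure μ],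
      MoeglinWaldspurger1989_partialPairL_of_eq_conj (n := N) (K := E) (μ := μ)) :
    GrbacShahidi2015_partialAsaiL_at_one :=
  GrbacShahidi2015_partialAsaiL_at_one_of_facts
    (GrbacShahidi2015_partialAsaiL_holomorphy_of_pos_of_two_le h) hMW

/-- **`Mok2014_partialAsaiL_continuation_pole_dichotomy` from the `As⁺` half of Grbac–Shahidi's
holomorphy in ranks `N ≥ 2` and Arthur–Clozel's (2.3)** — the accepted glue
`Mok2014_partialAsaiL_continuation_pole_dichotomy_of_GrbacShahidi2015_of_JS`
(`AsaiSignContOfAsaiHolomorphyMW`) composed with `GrbacShahidi2015_partialAsaiL_holomorphy_of_pos_of_two_le`.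
[cite: Mok2014, Thm. 2.5.4] [cite: GrbacShahidi2015, Thm. 4.3 (2)] [cite: ArthurClozelAMS120, Ch. 3 §2 (2.3)] -/
theorem Mok2014_partialAsaiL_continuation_pole_dichotomy_of_pos_of_JS
    (h : ∀ (F E : Type) [Field F] [NumberField F] [Field E] [NumberField E] [Algebra F E]
      (c : E ≃ₐ[F] E), Module.finrank F E = 2 → c ≠ 1 →
      ∀ (N : ℕ) (μ : Measure (gl N E).automorphicQuotient) [(gl N E).IsAutomorphicMeasure μ]
        (P : CuspidalAutomorphicRepGL N E μ), 2 ≤ N →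
        ∀ (S : Set (HeightOneSpectrum (𝓞 F))) (A : SatakeFamily E), S.Finite →
          IsSatakeFamilyOf P {w : HeightOneSpectrum (𝓞 E) | w.under (𝓞 F) ∈ S} A →
          (∀ w : HeightOneSpectrum (𝓞 E), w.under (𝓞 F) ∉ S → c • w = w →
            w.asIdeal.inertiaDeg (𝓞 F) = 2) →
          ∃ σ₀ : ℝ, 1 ≤ σ₀ ∧
            (∃ G : ℂ → ℂ, Differentiable ℂ G ∧
              ∀ s : ℂ, σ₀ < s.re → G s = s * (s - 1) * partialAsaiL S c A 1 s) ∧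
            ((¬ ∀ᶠ w : HeightOneSpectrum (𝓞 E) in cofinite, A (c • w) = (A w).map (·⁻¹)) →
              ∃ H : ℂ → ℂ, Differentiable ℂ H ∧
                ∀ s : ℂ, σ₀ < s.re → H s = partialAsaiL S c A 1 s))
    (h23 : ∀ (E : Type) [Field E] [NumberField E] (N : ℕ)
      (μ : Measure (gl N E).automorphicQuotient) [(gl N E).IsAutomorphicMeasure μ],
      JacquetShalika1981_partialPairL_pole_of_eq_conj (n := N) (K := E) (μ := μ)) :
    Mok2014_partialAsaiL_continuation_pole_dichotomy :=
  Mok2014_partialAsaiL_continuation_pole_dichotomy_of_GrbacShahidi2015_of_JS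
    (GrbacShahidi2015_partialAsaiL_holomorphy_of_pos_of_two_le h) h23

/-- **The conjugate-self-dual stratum of `GrbacShahidi2015_partialAsaiL_at_one` from the `As⁺` half of
the holomorphy in ranks `N ≥ 2` and Arthur–Clozel's (2.3)** (via
`GrbacShahidi2015_partialAsaiL_at_one_of_GrbacShahidi2015_of_JS_of_isConjSelfDualAE`, `AsaiAtOneConjSelfDualOfJS`).
[cite: GrbacShahidi2015, Thm. 4.3 (2), pp. 186 and 204] [cite: ArthurClozelAMS120, Ch. 3 §2 (2.3)] -/
theorem GrbacShahidi2015_partialAsaiL_at_one_of_pos_of_JS_of_isConjSelfDualAE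
    (h : ∀ (F E : Type) [Field F] [NumberField F] [Field E] [NumberField E] [Algebra F E]
      (c : E ≃ₐ[F] E), Module.finrank F E = 2 → c ≠ 1 →
      ∀ (N : ℕ) (μ : Measure (gl N E).automorphicQuotient) [(gl N E).IsAutomorphicMeasure μ]
        (P : CuspidalAutomorphicRepGL N E μ), 2 ≤ N →
        ∀ (S : Set (HeightOneSpectrum (𝓞 F))) (A : SatakeFamily E), S.Finite →
          IsSatakeFamilyOf P {w : HeightOneSpectrum (𝓞 E) | w.under (𝓞 F) ∈ S} A →
          (∀ w : HeightOneSpectrum (𝓞 E), w.under (𝓞 F) ∉ S → c • w = w →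
            w.asIdeal.inertiaDeg (𝓞 F) = 2) →
          ∃ σ₀ : ℝ, 1 ≤ σ₀ ∧
            (∃ G : ℂ → ℂ, Differentiable ℂ G ∧
              ∀ s : ℂ, σ₀ < s.re → G s = s * (s - 1) * partialAsaiL S c A 1 s) ∧
            ((¬ ∀ᶠ w : HeightOneSpectrum (𝓞 E) in cofinite, A (c • w) = (A w).map (·⁻¹)) →
              ∃ H : ℂ → ℂ, Differentiable ℂ H ∧
                ∀ s : ℂ, σ₀ < s.re → H s = partialAsaiL S c A 1 s))
    (h23 : ∀ (K : Type) [Field K] [NumberField K] (n : ℕ)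
      (μ : Measure (gl n K).automorphicQuotient) [(gl n K).IsAutomorphicMeasure μ],
      JacquetShalika1981_partialPairL_pole_of_eq_conj (n := n) (K := K) (μ := μ))
    (h2 : Module.finrank F E = 2) {c : E ≃ₐ[F] E} (hc : c ≠ 1) {N : ℕ} (hN : 0 < N)
    {hcpt : isCompact_glFiniteIntegralLevel N E} (π : CuspidalAutomorphicRepData N E hcpt)
    (hπ : π.1.IsConjSelfDualAE c) {S : Set (HeightOneSpectrum (𝓞 F))} {A : SatakeFamily E} (η : ℤˣ)
    (hSA : π.1.IsAsaiDatum c S A) :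
    ∃ σ₀ : ℝ, 1 ≤ σ₀ ∧
      (∀ s : ℂ, σ₀ < s.re →
        Multipliable fun v : {v : HeightOneSpectrum (𝓞 F) // v ∉ S} =>
          ((asaiLocalPolynomial c A η (placeAbove E v.1)).eval ((v.1.residueCard : ℂ) ^ (-s)))⁻¹) ∧
      ∃ (k : ℕ) (δ : ℝ) (G : ℂ → ℂ), k ≤ 1 ∧ 0 < δ ∧
        DifferentiableOn ℂ G ({s : ℂ | 1 < s.re} ∪ Metric.ball 1 δ) ∧
        (∀ s : ℂ, σ₀ < s.re → G s = (s - 1) ^ k * partialAsaiL S c A η s) ∧ G 1 ≠ 0 :=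
  GrbacShahidi2015_partialAsaiL_at_one_of_GrbacShahidi2015_of_JS_of_isConjSelfDualAE
    (GrbacShahidi2015_partialAsaiL_holomorphy_of_pos_of_two_le h) h23 h2 hc hN π hπ η hSA

end Consequences

/-! ### §5. Clause (2)(a) alone (the entire continuation of `s (s - 1) L^S(s, Π, As⁺)`), and the
archimedean Rankin–Selberg input of Humphries–Jo -/

section EntirePos

/-- **Sign reduction for the holomorphy clause (2)(a) alone, pointwise**: fix `E/F`, `c`, `N`, `μ`; if
for every cuspidal `P ≤ L²_cusp(GL_N(E) A_G \ GL_N(𝔸_E), μ)` and every admissible `(S, A)` some entire `G`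
has `G(s) = s (s - 1) L^S(s, A, As⁺)` far to the right, then the same holds for `As⁻` (the proof of
`asaiHolomorphyL2_of_pos` without its conjugate-self-duality bookkeeping: `L^S(s, A, As⁻) =
L^S(s, δ̂(ϖ) A, As⁺)` at the twist `P ⊗ δ̂`).  This is the hypothesis shape `hGSa` of the sibling files
`AsaiSignContOfAsaiHolomorphyMW` / `AsaiSignContOfHumphriesJo` / `AsaiAtOneConjSelfDualOfJS`.
[cite: GrbacShahidi2015, Thm. 4.3 (2)(a) and proof p. 206] [cite: Mok2014, §2.5 (arXiv p. 20)] -/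
theorem asaiEntireL2_of_pos (h2 : Module.finrank F E = 2) {c : E ≃ₐ[F] E} (hc : c ≠ 1) {N : ℕ}
    {μ : Measure (gl N E).automorphicQuotient} [(gl N E).IsAutomorphicMeasure μ]
    (hpos : ∀ (P : CuspidalAutomorphicRepGL N E μ) (S : Set (HeightOneSpectrum (𝓞 F)))
      (A : SatakeFamily E), S.Finite →
      IsSatakeFamilyOf P {w : HeightOneSpectrum (𝓞 E) | w.under (𝓞 F) ∈ S} A →
      (∀ w : HeightOneSpectrum (𝓞 E), w.under (𝓞 F) ∉ S → c • w = w →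
        w.asIdeal.inertiaDeg (𝓞 F) = 2) →
      ∃ σ₀ : ℝ, 1 ≤ σ₀ ∧ ∃ G : ℂ → ℂ, Differentiable ℂ G ∧
        ∀ s : ℂ, σ₀ < s.re → G s = s * (s - 1) * partialAsaiL S c A 1 s)
    (P : CuspidalAutomorphicRepGL N E μ) (S : Set (HeightOneSpectrum (𝓞 F))) (A : SatakeFamily E)
    (η : ℤˣ) (hS : S.Finite)
    (hA : IsSatakeFamilyOf P {w : HeightOneSpectrum (𝓞 E) | w.under (𝓞 F) ∈ S} A)
    (hin : ∀ w : HeightOneSpectrum (𝓞 E), w.under (𝓞 F) ∉ S → c • w = w →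
      w.asIdeal.inertiaDeg (𝓞 F) = 2) :
    ∃ σ₀ : ℝ, 1 ≤ σ₀ ∧ ∃ G : ℂ → ℂ, Differentiable ℂ G ∧
      ∀ s : ℂ, σ₀ < s.re → G s = s * (s - 1) * partialAsaiL S c A η s := by
  rcases Int.units_eq_one_or η with rfl | rfl
  · exact hpos P S A hS hA hin
  · obtain ⟨η₀, χ, hη₀, hχu, hres, hunr⟩ :=
      exists_heckeCharacter_restrict_eq_classFieldCharacter
        HewittRoss_heckeCharacter_extension_quadratic_holds F E c h2 hc
    have hχ₀ : ∀ t, χ (posRealIdele E t) = 1 := fun t => by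
      have h := hres (posRealIdele F t)
      rw [AdeleRing.ideleBaseChange_posRealIdele] at h
      rw [h]
      exact HeckeCharacter.map_posRealIdele_of_isFiniteOrder hη₀.isFiniteOrder t
    have he : ∀ w : HeightOneSpectrum (𝓞 E), w.under (𝓞 F) ∉ S →
        w.asIdeal.ramificationIdx (𝓞 F) = 1 :=
      fun w hw => HeightOneSpectrum.ramificationIdx_eq_one_of_asai h2 (hin w hw)
    have hA' : IsSatakeFamilyOf (P.twistByChar χ hχu hχ₀)
        {w : HeightOneSpectrum (𝓞 E) | w.under (𝓞 F) ∈ S}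
        (fun w => (A w).map (χ.valueAtUniformizer w * ·)) :=
      hA.twistByChar_of_isUnramifiedAt χ hχu hχ₀ fun w hw => hunr w (he w hw)
    obtain ⟨σ₀, hσ₀, G, hG, hGeq⟩ := hpos _ S _ hS hA' hin
    have heq : ∀ s : ℂ, partialAsaiL S c A (-1) s =
        partialAsaiL S c (fun w => (A w).map (χ.valueAtUniformizer w * ·)) 1 s :=
      fun s => partialAsaiL_neg_eq_partialAsaiL_heckeTwist h2 hc hη₀ hres hunr hin A 1 s
    exact ⟨σ₀, hσ₀, G, hG, fun s hs => by rw [hGeq s hs, heq s]⟩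

/-- **Clause (2)(a) for both signs and all ranks from its `As⁺` half in ranks `N ≥ 2`** (rank one
being the first conjunct of `GrbacShahidi2015_partialAsaiL_holomorphy_rank_one`): the hypothesis `hGSa`
of `Mok2014_partialAsaiL_continuation_pole_dichotomy_of_asaiEntire_of_JS` /
`…_of_asaiEntire_of_humphriesJo` from its `η = +1`, `N ≥ 2` part.
[cite: GrbacShahidi2015, Thm. 4.3 (2)(a) and proof p. 206] -/
theorem asaiEntireL2_of_pos_of_two_le
    (h : ∀ (F E : Type) [Field F] [NumberField F] [Field E] [NumberField E] [Algebra F E]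
      (c : E ≃ₐ[F] E), Module.finrank F E = 2 → c ≠ 1 →
      ∀ (N : ℕ) (μ : Measure (gl N E).automorphicQuotient) [(gl N E).IsAutomorphicMeasure μ]
        (P : CuspidalAutomorphicRepGL N E μ), 2 ≤ N →
        ∀ (S : Set (HeightOneSpectrum (𝓞 F))) (A : SatakeFamily E), S.Finite →
          IsSatakeFamilyOf P {w : HeightOneSpectrum (𝓞 E) | w.under (𝓞 F) ∈ S} A →
          (∀ w : HeightOneSpectrum (𝓞 E), w.under (𝓞 F) ∉ S → c • w = w →
            w.asIdeal.inertiaDeg (𝓞 F) = 2) →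
          ∃ σ₀ : ℝ, 1 ≤ σ₀ ∧ ∃ G : ℂ → ℂ, Differentiable ℂ G ∧
            ∀ s : ℂ, σ₀ < s.re → G s = s * (s - 1) * partialAsaiL S c A 1 s)
    (F E : Type) [Field F] [NumberField F] [Field E] [NumberField E] [Algebra F E]
    (c : E ≃ₐ[F] E) (h2 : Module.finrank F E = 2) (hc : c ≠ 1)
    (N : ℕ) (μ : Measure (gl N E).automorphicQuotient) [(gl N E).IsAutomorphicMeasure μ]
    (P : CuspidalAutomorphicRepGL N E μ) (hN : 0 < N)
    (S : Set (HeightOneSpectrum (𝓞 F))) (A : SatakeFamily E) (η : ℤˣ) (hS : S.Finite)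
    (hA : IsSatakeFamilyOf P {w : HeightOneSpectrum (𝓞 E) | w.under (𝓞 F) ∈ S} A)
    (hin : ∀ w : HeightOneSpectrum (𝓞 E), w.under (𝓞 F) ∉ S → c • w = w →
      w.asIdeal.inertiaDeg (𝓞 F) = 2) :
    ∃ σ₀ : ℝ, 1 ≤ σ₀ ∧ ∃ G : ℂ → ℂ, Differentiable ℂ G ∧
      ∀ s : ℂ, σ₀ < s.re → G s = s * (s - 1) * partialAsaiL S c A η s := by
  rcases Nat.lt_or_ge N 2 with hN2 | hN2
  · obtain rfl : N = 1 := by omega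
    obtain ⟨σ₀, hσ₀, hG, -⟩ :=
      GrbacShahidi2015_partialAsaiL_holomorphy_rank_one F E c h2 hc μ P S A η hS hA hin
    exact ⟨σ₀, hσ₀, hG⟩
  · exact asaiEntireL2_of_pos h2 hc (fun P S A hS hA hin => h F E c h2 hc N μ P hN2 S A hS hA hin)
      P S A η hS hA hin

/-- **Mok's dichotomy (`Mok2014_partialAsaiL_continuation_pole_dichotomy`) from the `As⁺`, `N ≥ 2` part of
Grbac–Shahidi's clause (2)(a) and Humphries–Jo's archimedean Rankin–Selberg test vectors (ranks `≥ 3`)**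
— `Mok2014_partialAsaiL_continuation_pole_dichotomy_of_asaiEntire_of_humphriesJo` (`AsaiSignContOfHumphriesJo`)
on `asaiEntireL2_of_pos_of_two_le`.  Leaf set of Mok's fact after this theorem: the entire continuation
of `s (s - 1) L^S(s, Π, As⁺)` for cuspidal `Π` on `GL_N(𝔸_E)`, `N ≥ 2` (Flicker 1988 / Grbac–Shahidi
(2)(a) for `r_A`), and `HumphriesJo2024_archRankinSelberg_testVector N E` for `N ≥ 3`.
[cite: Mok2014, §2.5 and Thm. 2.5.4 (a), p. 20] [cite: GrbacShahidi2015, Thm. 4.3 (2)(a), proof p. 206]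
[cite: HumphriesJo2024, Thm. 1.1 and Thm. 5.6] -/
theorem Mok2014_partialAsaiL_continuation_pole_dichotomy_of_posEntire_of_humphriesJo
    (h : ∀ (F E : Type) [Field F] [NumberField F] [Field E] [NumberField E] [Algebra F E]
      (c : E ≃ₐ[F] E), Module.finrank F E = 2 → c ≠ 1 →
      ∀ (N : ℕ) (μ : Measure (gl N E).automorphicQuotient) [(gl N E).IsAutomorphicMeasure μ]
        (P : CuspidalAutomorphicRepGL N E μ), 2 ≤ N →
        ∀ (S : Set (HeightOneSpectrum (𝓞 F))) (A : SatakeFamily E), S.Finite →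
          IsSatakeFamilyOf P {w : HeightOneSpectrum (𝓞 E) | w.under (𝓞 F) ∈ S} A →
          (∀ w : HeightOneSpectrum (𝓞 E), w.under (𝓞 F) ∉ S → c • w = w →
            w.asIdeal.inertiaDeg (𝓞 F) = 2) →
          ∃ σ₀ : ℝ, 1 ≤ σ₀ ∧ ∃ G : ℂ → ℂ, Differentiable ℂ G ∧
            ∀ s : ℂ, σ₀ < s.re → G s = s * (s - 1) * partialAsaiL S c A 1 s)
    (hHJ : ∀ (E : Type) [Field E] [NumberField E] (N : ℕ), 3 ≤ N →
      HumphriesJo2024_archRankinSelberg_testVector N E) :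
    Mok2014_partialAsaiL_continuation_pole_dichotomy :=
  Mok2014_partialAsaiL_continuation_pole_dichotomy_of_asaiEntire_of_humphriesJo
    (fun F E _ _ _ _ _ c h2 hc N μ _ P hN S A η hS hA hin =>
      asaiEntireL2_of_pos_of_two_le h F E c h2 hc N μ P hN S A η hS hA hin) hHJ

/-- **The conjugate-self-dual stratum of `GrbacShahidi2015_partialAsaiL_at_one` from the `As⁺`, `N ≥ 2`
part of clause (2)(a) and Humphries–Jo (ranks `≥ 3`)** — `GrbacShahidi2015_partialAsaiL_at_one_of_continuation_dichotomy`
(`AsaiSignCont`) on the previous theorem.  So for conjugate self-dual `Π` the named fact at `s = 1` has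
the same leaf set as Mok's dichotomy: Flicker's entire continuation for `As⁺` in ranks `≥ 2`, and
Humphries–Jo's archimedean test vectors in ranks `≥ 3`.
[cite: GrbacShahidi2015, Thm. 4.3 (2), pp. 186 and 204, proof pp. 204–206] [cite: HumphriesJo2024, Thm. 1.1 and Thm. 5.6] -/
theorem GrbacShahidi2015_partialAsaiL_at_one_of_posEntire_of_humphriesJo_of_isConjSelfDualAE
    (h : ∀ (F E : Type) [Field F] [NumberField F] [Field E] [NumberField E] [Algebra F E]
      (c : E ≃ₐ[F] E), Module.finrank F E = 2 → c ≠ 1 →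
      ∀ (N : ℕ) (μ : Measure (gl N E).automorphicQuotient) [(gl N E).IsAutomorphicMeasure μ]
        (P : CuspidalAutomorphicRepGL N E μ), 2 ≤ N →
        ∀ (S : Set (HeightOneSpectrum (𝓞 F))) (A : SatakeFamily E), S.Finite →
          IsSatakeFamilyOf P {w : HeightOneSpectrum (𝓞 E) | w.under (𝓞 F) ∈ S} A →
          (∀ w : HeightOneSpectrum (𝓞 E), w.under (𝓞 F) ∉ S → c • w = w →
            w.asIdeal.inertiaDeg (𝓞 F) = 2) →
          ∃ σ₀ : ℝ, 1 ≤ σ₀ ∧ ∃ G : ℂ → ℂ, Differentiable ℂ G ∧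
            ∀ s : ℂ, σ₀ < s.re → G s = s * (s - 1) * partialAsaiL S c A 1 s)
    (hHJ : ∀ (E : Type) [Field E] [NumberField E] (N : ℕ), 3 ≤ N →
      HumphriesJo2024_archRankinSelberg_testVector N E)
    (h2 : Module.finrank F E = 2) {c : E ≃ₐ[F] E} (hc : c ≠ 1) {N : ℕ} (hN : 0 < N)
    {hcpt : isCompact_glFiniteIntegralLevel N E} (π : CuspidalAutomorphicRepData N E hcpt)
    (hπ : π.1.IsConjSelfDualAE c) {S : Set (HeightOneSpectrum (𝓞 F))} {A : SatakeFamily E} (η : ℤˣ)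
    (hSA : π.1.IsAsaiDatum c S A) :
    ∃ σ₀ : ℝ, 1 ≤ σ₀ ∧
      (∀ s : ℂ, σ₀ < s.re →
        Multipliable fun v : {v : HeightOneSpectrum (𝓞 F) // v ∉ S} =>
          ((asaiLocalPolynomial c A η (placeAbove E v.1)).eval ((v.1.residueCard : ℂ) ^ (-s)))⁻¹) ∧
      ∃ (k : ℕ) (δ : ℝ) (G : ℂ → ℂ), k ≤ 1 ∧ 0 < δ ∧
        DifferentiableOn ℂ G ({s : ℂ | 1 < s.re} ∪ Metric.ball 1 δ) ∧
        (∀ s : ℂ, σ₀ < s.re → G s = (s - 1) ^ k * partialAsaiL S c A η s) ∧ G 1 ≠ 0 :=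
  GrbacShahidi2015_partialAsaiL_at_one_of_continuation_dichotomy
    (Mok2014_partialAsaiL_continuation_pole_dichotomy_of_posEntire_of_humphriesJo h hHJ) h2 hc hN π hπ
    η hSA

/-- **Pointwise: `GrbacShahidi2015_partialAsaiL_at_one` for ONE conjugate self-dual cuspidal `Π` on
`GL_N(𝔸_E)` from the `As⁺` half of clause (2)(a) at its own `(F, E, c, N)` and — only when `N ≥ 3` —
Humphries–Jo in rank `N` over `E`.**  (`asaiEntireL2_of_pos` feeds
`exists_sign_partialAsaiL_continuation_of_asaiEntire_of_humphriesJo`, then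
`AutomorphicRepData.partialAsaiL_at_one_of_sign_continuations`.)
[cite: GrbacShahidi2015, Thm. 4.3 (2), pp. 186 and 204] [cite: Mok2014, §2.5 and Thm. 2.5.4 (a)]
[cite: HumphriesJo2024, Thm. 1.1 and Thm. 5.6] -/
theorem CuspidalAutomorphicRepData.GrbacShahidi2015_partialAsaiL_at_one_of_asaiEntirePos_of_humphriesJo
    {c : E ≃ₐ[F] E} {N : ℕ} {hcpt : isCompact_glFiniteIntegralLevel N E}
    (hGSa : ∀ (μ : Measure (gl N E).automorphicQuotient) [(gl N E).IsAutomorphicMeasure μ]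
      (P : CuspidalAutomorphicRepGL N E μ) (S : Set (HeightOneSpectrum (𝓞 F))) (A : SatakeFamily E),
      S.Finite →
      IsSatakeFamilyOf P {w : HeightOneSpectrum (𝓞 E) | w.under (𝓞 F) ∈ S} A →
      (∀ w : HeightOneSpectrum (𝓞 E), w.under (𝓞 F) ∉ S → c • w = w →
        w.asIdeal.inertiaDeg (𝓞 F) = 2) →
      ∃ σ₀ : ℝ, 1 ≤ σ₀ ∧ ∃ G : ℂ → ℂ, Differentiable ℂ G ∧
        ∀ s : ℂ, σ₀ < s.re → G s = s * (s - 1) * partialAsaiL S c A 1 s)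
    (hHJ : 3 ≤ N → HumphriesJo2024_archRankinSelberg_testVector N E)
    (h2 : Module.finrank F E = 2) (hc : c ≠ 1) (hN : 0 < N) (π : CuspidalAutomorphicRepData N E hcpt)
    (hπ : π.1.IsConjSelfDualAE c) {S : Set (HeightOneSpectrum (𝓞 F))} {A : SatakeFamily E} (η : ℤˣ)
    (hSA : π.1.IsAsaiDatum c S A) :
    ∃ σ₀ : ℝ, 1 ≤ σ₀ ∧
      (∀ s : ℂ, σ₀ < s.re →
        Multipliable fun v : {v : HeightOneSpectrum (𝓞 F) // v ∉ S} =>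
          ((asaiLocalPolynomial c A η (placeAbove E v.1)).eval ((v.1.residueCard : ℂ) ^ (-s)))⁻¹) ∧
      ∃ (k : ℕ) (δ : ℝ) (G : ℂ → ℂ), k ≤ 1 ∧ 0 < δ ∧
        DifferentiableOn ℂ G ({s : ℂ | 1 < s.re} ∪ Metric.ball 1 δ) ∧
        (∀ s : ℂ, σ₀ < s.re → G s = (s - 1) ^ k * partialAsaiL S c A η s) ∧ G 1 ≠ 0 :=
  AutomorphicRepData.partialAsaiL_at_one_of_sign_continuations
    (π.exists_sign_partialAsaiL_continuation_of_asaiEntire_of_humphriesJo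
      (fun μ _ P S A θ hS hA hin => asaiEntireL2_of_pos h2 hc (hGSa μ) P S A θ hS hA hin) hHJ h2 hc
      hN hπ) η hSA

end EntirePos

end Literature.NumberTheory.Automorphic
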